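import Literature.MathematicalPhysics.QuantumManyBody.OneBodyCurrentGain
import Mathlib.Algebra.QuadraticDiscriminant
import HarnessLib

/-!
# The phase-unwinding gain functional: scaling and the Kipnis–Varadhan form of `GAIN*`

Topic `Literature/MathematicalPhysics/QuantumManyBody`, companion of `OneBodyCurrentGain.lean`
(definition item `defn-CoarseModeRayPOVM`; route `BECIroning` of
`AtomisticToContinuum/BoseEinsteinCondensation`, items `IroningLink` / `IroningCost`). That file
defines the gain `GAIN(θ; Φ) = 2∫_{cell} ∇θ·j_Φ - ∫_{cell} |∇θ|² n_Φ` of a configuration-space phase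
unitary and `GAIN*(Φ) = sup_θ GAIN(θ; Φ)` (`maxPhaseGain`), and lists as "deliberately not here"
the Kipnis–Varadhan form of `GAIN*`, "routine from `maxPhaseGain_le_ofReal_iff` by scaling
`θ ↦ tθ`". This file supplies exactly that:

* `phaseGain_smul`: `GAIN(tθ; Φ) = 2t·A(θ) - t²·B(θ)` with the current pairing
  `A(θ) = ∫_{cell} ∇θ·j_Φ` and the density pairing `B(θ) = ∫_{cell} |∇θ|² n_Φ` (`B ≥ 0`,
  `densityPairing_nonneg`);
* **`ofReal_sq_div_le_maxPhaseGain`**: `A(θ)²/B(θ) ≤ GAIN*(Φ)` for every admissible phase — the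
  optimal-amplitude lower bound (test against `tθ`, `t = A/B`), the form in which every lower bound
  on the unwinding gain (the route's LINK) is obtained;
* **`maxPhaseGain_le_ofReal_iff_sq`** (Kipnis–Varadhan's criterion): for `C ≥ 0`,
  `GAIN*(Φ) ≤ C ↔ ∀ θ admissible, A(θ)² ≤ C·B(θ)` — the form in which every upper bound (the
  route's ironing inequality `GAIN ≤ COST`) is consumed.

The proofs copy those of `hMinusOneSqW_le_ofReal_iff` / `le_hMinusOneSqW` in
`WeightedCorrector.lean` (the `N`-body `H₋₁` norm), of which `maxPhaseGain` is the one-body,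
current-weighted analogue. No definitions, no named facts.

## References

* [KipnisVaradhan1986] C. Kipnis, S. R. S. Varadhan, Comm. Math. Phys. 104 (1986) 1–19: (1.14)
  (the variational `H₋₁` condition `|⟨V, φ⟩| ≤ C^{1/2}⟨-Lφ, φ⟩^{1/2}`).
* [LSSY2005] E. H. Lieb, R. Seiringer, J. P. Solovej, J. Yngvason, *The Mathematics of the Bose Gas
  and its Condensation*, Birkhäuser 2005: §5.2 (5.19)–(5.23) (gauge transformation `p ↦ p - ∇θ`).
-/

noncomputable section

open MeasureTheory Metric
open scoped ENNReal NNReal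

namespace Literature.MathematicalPhysics.QuantumManyBody.BoseGas

variable {N : ℕ} {L : ℝ} {Φ : Config N → ℂ} {θ : Space → ℝ}

/-- Scaling of the phase gradient: `∂ₖ(tθ)(x) = t ∂ₖθ(x)` for differentiable `θ`. [folklore] -/
theorem fderiv_smul_phase_apply (hθ : Differentiable ℝ θ) (t : ℝ) (x : Space) (k : Fin 3) :
    fderiv ℝ (t • θ) x (EuclideanSpace.single k 1) = t * fderiv ℝ θ x (EuclideanSpace.single k 1) := by
  rw [fderiv_const_smul (hθ x) t]
  rfl

/-- **Scaling of the gain in the phase**: `GAIN(tθ; Φ) = 2t ∫_{cell} ∇θ·j_Φ - t² ∫_{cell} |∇θ|² n_Φ`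
(the gain is a concave quadratic polynomial along each ray of phases). [cite: LSSY2005, §5.2 (5.19)–(5.23)] -/
theorem phaseGain_smul (hθ : Differentiable ℝ θ) (t : ℝ) (L : ℝ) (N : ℕ) (Φ : Config N → ℂ) :
    phaseGain L N Φ (t • θ) =
      2 * t * (∫ x in cell L, ∑ k : Fin 3,
          fderiv ℝ θ x (EuclideanSpace.single k 1) * oneBodyCurrent L N Φ k x) -
        t ^ 2 * ∫ x in cell L, (∑ k : Fin 3, fderiv ℝ θ x (EuclideanSpace.single k 1) ^ 2) *
          oneBodyDensity L N Φ x := by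
  unfold phaseGain
  simp only [fderiv_smul_phase_apply hθ]
  have h1 : (fun x => ∑ k : Fin 3, t * fderiv ℝ θ x (EuclideanSpace.single k 1) *
      oneBodyCurrent L N Φ k x) = fun x => t * ∑ k : Fin 3,
        fderiv ℝ θ x (EuclideanSpace.single k 1) * oneBodyCurrent L N Φ k x := by
    funext x
    rw [Finset.mul_sum]
    exact Finset.sum_congr rfl fun k _ => by ring
  have h2 : (fun x => (∑ k : Fin 3, (t * fderiv ℝ θ x (EuclideanSpace.single k 1)) ^ 2) *
      oneBodyDensity L N Φ x) = fun x => t ^ 2 * ((∑ k : Fin 3,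
        fderiv ℝ θ x (EuclideanSpace.single k 1) ^ 2) * oneBodyDensity L N Φ x) := by
    funext x
    have hs : ∑ k : Fin 3, (t * fderiv ℝ θ x (EuclideanSpace.single k 1)) ^ 2 =
        t ^ 2 * ∑ k : Fin 3, fderiv ℝ θ x (EuclideanSpace.single k 1) ^ 2 := by
      rw [Finset.mul_sum]
      exact Finset.sum_congr rfl fun k _ => by ring
    rw [hs]
    ring
  rw [h1, h2, integral_const_mul, integral_const_mul]
  ring

/-- The density pairing is non-negative: `0 ≤ ∫_{cell} |∇θ|² n_Φ` (`n_Φ ≥ 0`). [folklore] -/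
theorem densityPairing_nonneg (L : ℝ) (N : ℕ) (Φ : Config N → ℂ) (θ : Space → ℝ) :
    0 ≤ ∫ x in cell L, (∑ k : Fin 3, fderiv ℝ θ x (EuclideanSpace.single k 1) ^ 2) *
      oneBodyDensity L N Φ x :=
  setIntegral_nonneg (measurableSet_cell L) fun x _ =>
    mul_nonneg (Finset.sum_nonneg fun _ _ => sq_nonneg _) (oneBodyDensity_nonneg L N Φ x)

/-- **The optimal-amplitude lower bound** (`t = A/B` in `GAIN(tθ) = 2tA - t²B`): for every admissible
phase `θ`, `(∫_{cell} ∇θ·j_Φ)² / ∫_{cell} |∇θ|² n_Φ ≤ GAIN*(Φ)` (with Lean's `a/0 = 0` the statement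
is unconditional; formally `GAIN* = ∫|P_∇ j_Φ|²/n_Φ` is the supremum of the left side).
[cite: KipnisVaradhan1986, (1.14)] -/
theorem ofReal_sq_div_le_maxPhaseGain (hθ : IsPeriodicPhase L θ) (N : ℕ) (Φ : Config N → ℂ) :
    ENNReal.ofReal ((∫ x in cell L, ∑ k : Fin 3,
        fderiv ℝ θ x (EuclideanSpace.single k 1) * oneBodyCurrent L N Φ k x) ^ 2 /
        ∫ x in cell L, (∑ k : Fin 3, fderiv ℝ θ x (EuclideanSpace.single k 1) ^ 2) *
          oneBodyDensity L N Φ x) ≤ maxPhaseGain L N Φ := by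
  set A : ℝ := ∫ x in cell L, ∑ k : Fin 3,
    fderiv ℝ θ x (EuclideanSpace.single k 1) * oneBodyCurrent L N Φ k x with hA
  set B : ℝ := ∫ x in cell L, (∑ k : Fin 3, fderiv ℝ θ x (EuclideanSpace.single k 1) ^ 2) *
    oneBodyDensity L N Φ x with hB
  rcases le_or_gt B 0 with hB0 | hBpos
  · -- `B ≤ 0` (so `B = 0`): the left side is `ofReal` of a non-positive number
    have h : A ^ 2 / B ≤ 0 := div_nonpos_of_nonneg_of_nonpos (sq_nonneg A) hB0
    rw [ENNReal.ofReal_of_nonpos h]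
    exact bot_le
  · have hBne : B ≠ 0 := hBpos.ne'
    have hsq : (A / B) ^ 2 * B = A ^ 2 / B := by
      rw [div_pow, div_mul_eq_mul_div, pow_two B, mul_div_mul_right _ _ hBne]
    have hgain : phaseGain L N Φ ((A / B) • θ) = A ^ 2 / B := by
      rw [phaseGain_smul hθ.differentiable, ← hA, ← hB, hsq]
      ring
    calc ENNReal.ofReal (A ^ 2 / B) = ENNReal.ofReal (phaseGain L N Φ ((A / B) • θ)) := by rw [hgain]
      _ ≤ maxPhaseGain L N Φ := le_maxPhaseGain L N Φ (hθ.smul (A / B))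

/-- **Kipnis–Varadhan's criterion for the unwinding gain.** For `C ≥ 0`: `GAIN*(Φ) ≤ C` iff
`(∫_{cell} ∇θ·j_Φ)² ≤ C · ∫_{cell} |∇θ|² n_Φ` for every admissible phase `θ` (`⇒`: test `GAIN(tθ) ≤ C`
for all `t` and read off the discriminant; `⇐`: `2A - B ≤ C` whenever `A² ≤ CB`, `B ≥ 0`).
[cite: KipnisVaradhan1986, (1.14)] -/
theorem maxPhaseGain_le_ofReal_iff_sq {C : ℝ} (hC : 0 ≤ C) :
    maxPhaseGain L N Φ ≤ ENNReal.ofReal C ↔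
      ∀ θ : Space → ℝ, IsPeriodicPhase L θ →
        (∫ x in cell L, ∑ k : Fin 3,
            fderiv ℝ θ x (EuclideanSpace.single k 1) * oneBodyCurrent L N Φ k x) ^ 2 ≤
          C * ∫ x in cell L, (∑ k : Fin 3, fderiv ℝ θ x (EuclideanSpace.single k 1) ^ 2) *
            oneBodyDensity L N Φ x := by
  rw [maxPhaseGain_le_ofReal_iff hC]
  constructor
  · intro h θ hθ
    set A : ℝ := ∫ x in cell L, ∑ k : Fin 3,
      fderiv ℝ θ x (EuclideanSpace.single k 1) * oneBodyCurrent L N Φ k x with hA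
    set B : ℝ := ∫ x in cell L, (∑ k : Fin 3, fderiv ℝ θ x (EuclideanSpace.single k 1) ^ 2) *
      oneBodyDensity L N Φ x with hB
    have hq : ∀ t : ℝ, 0 ≤ B * (t * t) + -(2 * A) * t + C := by
      intro t
      have ht := h (t • θ) (hθ.smul t)
      rw [phaseGain_smul hθ.differentiable, ← hA, ← hB] at ht
      nlinarith [ht]
    have hdisc := discrim_le_zero hq
    rw [discrim] at hdisc
    nlinarith [hdisc]
  · intro h θ hθ
    have h1 := h θ hθ
    have hB := densityPairing_nonneg L N Φ θ
    have hone := phaseGain_smul hθ.differentiable 1 L N Φ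
    rw [one_smul] at hone
    rw [hone]
    set A : ℝ := ∫ x in cell L, ∑ k : Fin 3,
      fderiv ℝ θ x (EuclideanSpace.single k 1) * oneBodyCurrent L N Φ k x
    set B : ℝ := ∫ x in cell L, (∑ k : Fin 3, fderiv ℝ θ x (EuclideanSpace.single k 1) ^ 2) *
      oneBodyDensity L N Φ x
    by_contra hlt
    rw [not_le] at hlt
    have h2 : 0 < 2 * 1 * A - 1 ^ 2 * B - C := by linarith
    have h3 : 0 < 2 * A + B + C := by nlinarith
    nlinarith [mul_pos h2 h3, sq_nonneg (C - B)]

/-- `GAIN*(Φ) = 0` as soon as every current pairing vanishes (e.g. `j_Φ = 0`: a currentless state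
cannot be unwound). [folklore] -/
theorem maxPhaseGain_eq_zero_of_currentPairing_eq_zero
    (h : ∀ θ : Space → ℝ, IsPeriodicPhase L θ →
      (∫ x in cell L, ∑ k : Fin 3,
        fderiv ℝ θ x (EuclideanSpace.single k 1) * oneBodyCurrent L N Φ k x) = 0) :
    maxPhaseGain L N Φ = 0 := by
  rw [← nonpos_iff_eq_zero, ← ENNReal.ofReal_zero]
  refine (maxPhaseGain_le_ofReal_iff_sq le_rfl).mpr fun θ hθ => ?_
  rw [h θ hθ, zero_mul]
  norm_num

end Literature.MathematicalPhysics.QuantumManyBody.BoseGas
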